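import Summits.BirchSwinnertonDyer.Rank1Residual.Additive.XGordRankZeroOneCyclotomicThreePrep
import Summits.BirchSwinnertonDyer.Rank1Residual.Additive.CyclotomicZpExtensionQuadratic
import Summits.BirchSwinnertonDyer.Rank1Residual.Additive.ChiBranchConstantTermOdd
import HarnessLib

/-!
# Ranks `(0,1)` at `p = 3` over `K = ℚ(ζ₃)`: `ord₃ #Ш(V) + ord₃ #Ш(W) ≤ ord₃ #Ш_an(V) + ord₃ #Ш_an(W)`
# for the additive twist `W ≅ V^{(−3)}` of analytic rank `0` of a good ordinary `V` of analytic
# rank `1`, given the certificate `[T¹]L₃(V,T) ≠ 0` (line V17, core theorem)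

HONEST FRAMING (cell `b2b-bsdres`, run/shared/lean/b2b/bsd-rank1-residual/, verbatim in every
file): the goal of the cell is to DELETE the COMBINATION-SHAPED residual classes of the
Birch–Swinnerton-Dyer formula for ALL analytic-rank `≤ 1` elliptic curves over `ℚ` — "full BSD
formula for every rank `≤ 1` curve in class `C`" assembled STRICTLY from published theorems — so
that the rank-`≤ 1` remainder becomes exactly the CONSTRUCTION-SHAPED classes, which are TYPED
(missing-input `Prop`s), NOT attempted. This is not "finishing BSD". Seat additive-p4, gen 7
(research route on X3/X4); the labels of X3/X4 (and of X1/X10 for the twist pair) are UNCHANGED by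
this file; nothing is booked here.

Theorems only (no `def`, no `sorry`, no new named fact). Lines V14/V14b settled the rank-`(0,0)` rows
of the additive classes at `p = 3` whose twist `V = W^{(−3)}` is good ordinary, by reading Wuthrich's
/ Kato's two-branch divisibility over `K_∞ = ℚ(ζ_{3^∞})`, the cyclotomic `ℤ₃`-extension of
`K = ℚ(ζ₃)`, and descending with Greenberg's Euler characteristic (Thm. 4.1 over `K`) and Milne. Here
the SAME reading handles the rows with `r_an(W) = 0`, `r_an(V) = 1` (so `rank V(K) = 1`): the
rank-zero Euler characteristic is replaced by **Schneider's rank-one leading term over `K`**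
(Greenberg LNM 1716 p. 110, named reading-fact
`Greenberg1999.schneider_charCoeff_rankOne_quadraticBaseChange`, here INLINE as `hS1K` in its
`K`-shape), whose `3`-adic height of the `K`-generator `Q` is `2·Reg₃(V)/m²` with `m ∣ 2`
(`CyclotomicThreeRankOneDescentData`), and the analytic side of `V` is **Perrin-Riou's `3`-adic
Gross–Zagier comparison** in rank one (`perrinRiou_rankOne_leadingTerms_odd`, through the tree's
engine `Wuthrich2014.exists_rat_leadingTerms_of_analyticRank_eq_one_odd`:
`[T¹]L₃(V)·log₃γ = q·(1−α⁻¹)²·Reg₃(V)`, `L'(V,1) = q·Ω⁺_f·Reg_∞(V)`), so that BOTH regulators cancel;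
Milne's identity is read with `m²·Reg(V_K) = 2·Reg(V)` (`CyclotomicThreeRankOneCardIdentity`). The
one per-row input beyond the unit bits is the CERTIFICATE `[T¹]L₃(f_V, α) ≠ 0` (`hcert`; a finite
`3`-adic computation — Stein–Wuthrich 2013 §3; equivalently Schneider's non-degeneracy for `V` at `3`),
which forces `ord_T f_{V_K} = 1`, `h(0) ≠ 0` and `h₃(Q) ≠ 0` through the divisibility.

Chain: `h(0)·[T¹]f = uϖϖ'·[T¹]L⁺·L⁻(0)`; [S_K]; PR; `m²h₃(Q) = 2Reg₃`; `(1−α⁻¹)² ∼ #Ṽ(𝔽₃)[3]²`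
⟹ `v(Tam V_K) + ord#Ш(V_K) − 2ord#V(K)_tors ≤ ord(qϖ) + ord(ϖ'S⁻)`; Milne (rank `(0,1)`) and the two
analytic sides (`XGordRankZeroOneCyclotomicThreePrep`) finish. Assumed (explicit hypotheses, nothing asserted): published — `hW16K` (Wuthrich Thm. 16 / Kato over
`K`, K-shape, as in V14), `hS1K` (Greenberg p. 110 over `K`, K-shape), `hPR`, `hMilne`, `hGZK`, `hmod`;
per row — `C`, `hord`, `hadd`, the two analytic ranks, `hcert`. Facts-only corollaries (X3: Wuthrich;
X4: Kato) and the census: `XGordRankZeroOneCyclotomicThreeFacts.lean`.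
-/

noncomputable section

open scoped Classical MatrixGroups ModularForm

open CongruenceSubgroup WeierstrassCurve NumberField IsDedekindDomain
  Literature.NumberTheory.EllipticCurves Literature.NumberTheory.EllipticCurves.ModularForms
  Literature.NumberTheory.EllipticCurves.Rank1Residual
  Literature.NumberTheory.EllipticCurves.Rank1Residual.Typed
  Literature.NumberTheory.GaloisRepresentations

namespace Summit.BirchSwinnertonDyer.Rank1Residual.Additive

section Core

variable (K : Type) [Field K] [NumberField K] [IsCyclotomicExtension {3} ℚ K]
  (V : WeierstrassCurve ℚ) [V.IsElliptic] [V.IsGloballyMinimal]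
  (W : WeierstrassCurve ℚ) [W.IsElliptic] [W.IsGloballyMinimal]

/-- **Core theorem (line V17, `p = 3`, ranks `(0,1)`).** Let `V/ℚ` be globally minimal, good ORDINARY
at `3`, of analytic rank `1`, and `W = C • V^{(−3)}` a globally minimal model of its twist by
`−3 = d_K`, `K = ℚ(ζ₃)`, ADDITIVE at `3`, of analytic rank `0`; `f` the newform of `V`,
`ϖ·Ω_V = Ω⁺_f`, `ϖ'·|Ω⁻(V)| = Ω⁻_f`, `Dh` THE canonical `3`-adic height of `V`, and the certificate
`[T¹]L₃(f,α) ≠ 0`. ASSUME over `K`: `hW16K` (Wuthrich Thm. 16 / Kato over `K`: `X(V/K_∞)` torsion,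
`u ϖϖ'·L₃(V,ω⁰,T)·L₃(V,ω¹,T) = ι g`, `g ∈ char`) and `hS1K` (Greenberg p. 110 = Schneider's rank-one
leading term for `V_K`, in the shape of `Greenberg1999.schneider_charCoeff_rankOne_quadraticBaseChange`
with `#Ẽ_𝔭(k_𝔭) = #V(𝔽₃)`). THEN, with Perrin-Riou 1987 (`hPR`), Milne 1972 (`hMilne`), GZK, modularity:
`#Ш_an(V) = q_V`, `#Ш_an(W) = q_W` are rationals with
**`ord₃ #Ш(V) + ord₃ #Ш(W) ≤ ord₃ q_V + ord₃ q_W`**. [cite: GreenbergLNM1716, §4 p. 110]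
[cite: PerrinRiou1987, §1.4 Cor. 1.8] [cite: Wuthrich2014, Thm. 16 (p. 397)] [cite: Milne1972ArithmeticAV, §1 Thm. 1] -/
theorem XGordRankZeroOneCyclotomicThree.exists_padicVal_shaOrder_add_le
    (hPR : perrinRiou_rankOne_leadingTerms_odd)
    (hGZK : rank_eq_analyticRank_of_analyticRank_le_one) (hmod : hasEntireLFunction_rat)
    (hMilne : Milne1972.bsdQuotient_baseChange_quadratic_anyModel)
    (C : VariableChange ℚ) (hC : C • V.quadraticTwist (-(3 : ℚ)) = W)
    (hord : IsOrdinaryAt V 3) (hadd : Addv W 3)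
    (hrV : V.analyticRank = 1) (hrW : W.analyticRank = 0)
    {N : ℕ} [NeZero N] {f : CuspForm (Gamma0 N) 2} (hf : IsNewformOf V f)
    (ϖ ϖ' : ℚ) (hϖ : (ϖ : ℝ) * V.realPeriodRat = plusPeriod f)
    (hϖ' : (ϖ' : ℝ) * V.imaginaryPeriodRat = minusPeriod f)
    (Dh : PAdicHeightData V 3) (hDh : Dh.IsCanonical)
    (hcert : PowerSeries.coeff 1 (padicLFunction f ((unitRoot V 3 : ℤ_[3]) : ℚ_[3])) ≠ 0)
    (hW16K : ∀ (κ : ZpExtension K 3) (γ : Field.absoluteGaloisGroup K),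
      κ.IsCyclotomic → κ.IsTopGenerator γ →
      (∃ ζ : ℤ_[3]ˣ, IsOfFinOrder ζ ∧
        ((GaloisRep.cyclotomicCharacter K 3 γ * ζ : ℤ_[3]ˣ) : ℤ_[3]) = (cyclotomicGenerator 3 : ℤ_[3])) →
      ∀ D : (V.baseChange K).SelmerDualData κ γ,
        D.IsTorsion ∧ ∃ g ∈ D.charIdeal, ∃ u : ℤ_[3]ˣ,
          iwasawaToPowerSeries 3 g =
            PowerSeries.C (((u : ℤ_[3]) : ℚ_[3]) * (ϖ : ℚ_[3]) * (ϖ' : ℚ_[3])) *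
              (padicLFunction f ((unitRoot V 3 : ℤ_[3]) : ℚ_[3]) *
                padicLFunctionMinusBranch f ((unitRoot V 3 : ℤ_[3]) : ℚ_[3]) 1))
    (hS1K : ∀ (κ : ZpExtension K 3) (γ : Field.absoluteGaloisGroup K),
      κ.IsCyclotomic → κ.IsTopGenerator γ →
      (∃ ζ : ℤ_[3]ˣ, IsOfFinOrder ζ ∧
        ((GaloisRep.cyclotomicCharacter K 3 γ * ζ : ℤ_[3]ˣ) : ℤ_[3]) = (cyclotomicGenerator 3 : ℤ_[3])) →
      ∀ (D : (V.baseChange K).SelmerDualData κ γ) [Module.Finite (IwasawaAlgebra 3) D.X], D.IsTorsion →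
      ∀ (fE : IwasawaAlgebra 3), D.charIdeal = Ideal.span {fE} →
        (V.baseChange K).mordellWeilRank = 1 →
        Finite (AddCommGroup.primaryComponent (V.baseChange K).sha 3) →
      ∀ (Q : (V.baseChange K).toAffine.Point), IsMordellWeilBasis (fun _ : Fin 1 => Q) →
      ∀ (Dh : PAdicHeightData V 3), Dh.IsCanonical →
        PowerSeries.X ∣ fE ∧
        ∃ DK : PAdicHeightDataK V 3 K, DK.RestrictsTo Dh ∧
          ∃ u : ℤ_[3]ˣ,
            ((PowerSeries.coeff 1 fE : ℤ_[3]) : ℚ_[3]) * padicLog 3 (cyclotomicGenerator 3) *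
                (Nat.card (AddCommGroup.primaryComponent (V.baseChange K).toAffine.Point 3) : ℚ_[3]) ^ 2 =
              ((u : ℤ_[3]) : ℚ_[3]) * DK.pairing Q Q *
                (3 : ℚ_[3]) ^ (padicValNat 3 (V.baseChange K).tamagawaProduct) *
                (Nat.card (AddCommGroup.primaryComponent
                  ((integralModelInt V).map (Int.castRingHom (ZMod 3))).toAffine.Point 3) : ℚ_[3]) ^ 2 *
                (Nat.card (AddCommGroup.primaryComponent (V.baseChange K).sha 3) : ℚ_[3])) :
    ∃ qV qW : ℚ, shaAn V = (qV : ℂ) ∧ shaAn W = (qW : ℂ) ∧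
      (padicValNat 3 V.shaOrder : ℤ) + padicValNat 3 W.shaOrder ≤ padicValRat 3 qV + padicValRat 3 qW := by
  classical
  -- §0 facts about `K`
  have h2 : Module.finrank ℚ K = 2 := finrank_eq_two_of_isCyclotomicExtension_three (K := K)
  have hdK : (NumberField.discr K : ℚ) = -(3 : ℚ) := by
    rw [discr_cyclotomicThree K]; norm_num
  haveI : IsTotallyComplex K := isTotallyComplex_cyclotomicThree K
  have hC' : C • V.quadraticTwist (NumberField.discr K : ℚ) = W := by rw [hdK]; exact hC
  -- ranks and finiteness over `ℚ`
  obtain ⟨hmwV, hfinV⟩ := hGZK V (by rw [hrV])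
  obtain ⟨hmwW, hfinW⟩ := hGZK W (by rw [hrW]; exact zero_le_one)
  haveI : Finite V.sha := hfinV
  haveI : Finite W.sha := hfinW
  have hr1 : V.mordellWeilRank = 1 := by rw [hmwV, hrV]
  haveI hEW : Finite W.toAffine.Point := W.finite_point_of_rank_zero (by rw [hmwW, hrW])
  -- the canonical `K`-model `V ⊗ K`: rank one, Milne's identity
  set VK := V.baseChange K with hVK
  haveI : VK.IsElliptic := by rw [hVK, WeierstrassCurve.baseChange]; infer_instance
  haveI : Module.Finite ℤ VK.toAffine.Point := VK.module_finite_point_holds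
  have hd0 : (NumberField.discr K : ℚ) ≠ 0 := by rw [hdK]; norm_num
  haveI := V.isElliptic_quadraticTwist hd0
  have htw0 : (V.quadraticTwist (NumberField.discr K : ℚ)).mordellWeilRank = 0 := by
    rw [← mordellWeilRank_variableChange_holds (V.quadraticTwist (NumberField.discr K : ℚ)) C, hC']
    exact W.mordellWeilRank_eq_zero_of_finite
  have hrK : VK.mordellWeilRank = 1 := by
    rw [hVK, V.mordellWeilRank_baseChange_of_finrank_eq_two_of_finite K h2, hr1, htw0]
  obtain ⟨hshaK, hWR⟩ := hMilne V K h2 W ⟨C, hC'⟩ VK ⟨1, one_smul _ _⟩ hfinV hfinW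
  haveI : Finite VK.sha := hshaK
  have hfinShaKp : Finite (AddCommGroup.primaryComponent VK.sha 3) :=
    Finite.of_injective _ Subtype.val_injective
  -- Mordell–Weil generators `P₀` of `V(ℚ)` and `Q` of `V(K)`; the index lemma `ι P₀ = m Q + t`, `m ∣ 2`
  obtain ⟨B₀, hB₀⟩ := V.exists_isMordellWeilBasis_holds
  obtain ⟨BK, hBK⟩ := VK.exists_isMordellWeilBasis_holds
  have hcard₀ : Fintype.card (Fin V.mordellWeilRank) = 1 := by rw [Fintype.card_fin, hr1]
  have hcardK : Fintype.card (Fin VK.mordellWeilRank) = 1 := by rw [Fintype.card_fin, hrK]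
  let k₀ : Fin V.mordellWeilRank := ⟨0, by omega⟩
  let kK : Fin VK.mordellWeilRank := ⟨0, by omega⟩
  have hP₀ : IsMordellWeilBasis (fun _ : Fin 1 => B₀ k₀) := isMordellWeilBasis_const_of_card_eq_one hB₀ hcard₀ k₀
  have hQ : IsMordellWeilBasis (fun _ : Fin 1 => BK kK) := isMordellWeilBasis_const_of_card_eq_one hBK hcardK kK
  haveI : NeZero (2 : ℚ) := ⟨two_ne_zero⟩
  obtain ⟨m, t, ht, hm2, hmQ⟩ := incl_generator_eq_zsmul_of_quadratic V h2 hP₀ hQ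
  have hmQ' : V.pointToBaseChange K (B₀ k₀) = m • BK kK + t := by
    rw [pointToBaseChange_eq_baseChange]; exact hmQ
  have hm0 : m ≠ 0 := by
    rintro rfl
    exact two_ne_zero (zero_dvd_iff.mp hm2)
  have hm3 : ¬ (3 : ℤ) ∣ m := by
    intro h3
    have : (3 : ℤ) ∣ 2 := dvd_trans h3 hm2
    omega
  -- Milne in rank `(0,1)`, in valuations
  obtain ⟨hM0, hvcard⟩ := padicVal_card_identity_rankZeroOne K V W h2 3 (by norm_num) hC' hfinV hfinW
    hshaK hP₀ hQ hm2 ht hmQ' hWR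
  have hvM : padicValRat 3 VK.modifiedTamagawaProduct = padicValNat 3 VK.tamagawaProduct :=
    padicValRat_modifiedTamagawaProduct_baseChange V 3
      (fun hdvd ↦ V.not_hasGoodReductionAtPrime_of_dvd_minimalDiscriminantInt 3 hdvd hord.1)
  rw [← hVK] at hvcard
  rw [hvM] at hvcard
  -- the cyclotomic setting over `K`, the Iwasawa module `X(V/K_∞)`
  obtain ⟨κ, hκ, γ, hγ, hγ'⟩ := exists_isCyclotomic_isTopGenerator_cyclotomicThree K
  obtain ⟨D⟩ := VK.nonempty_selmerDualData_holds κ γ hγ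
  haveI : Module.Finite (IwasawaAlgebra 3) D.X :=
    (SelmerDualData.module_finite_of_isCyclotomic (W := VK) (κ := κ) hκ D) hγ
  -- [B₃] Wuthrich / Kato over `K`
  obtain ⟨hX, g, hgmem, u, hιg⟩ := hW16K κ γ hκ hγ hγ' D
  haveI : (Module.charIdeal (IwasawaAlgebra 3) D.X).IsPrincipal := charIdeal_isPrincipal_holds 3 D.X
  obtain ⟨fE, hchar⟩ := Submodule.IsPrincipal.principal (Module.charIdeal (IwasawaAlgebra 3) D.X)
  have hchar' : D.charIdeal = Ideal.span {fE} := hchar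
  have hgmem' : g ∈ Ideal.span {fE} := by rw [← hchar']; exact hgmem
  obtain ⟨h, hgh⟩ := Ideal.mem_span_singleton'.mp hgmem'
  -- [S_K] Schneider's rank-one leading term over `K`
  obtain ⟨⟨qq, hqq⟩, DK, hres, u₁, hu₁⟩ := hS1K κ γ hκ hγ hγ' D hX fE hchar' hrK hfinShaKp (BK kK) hQ Dh hDh
  -- heights: `m² h₃(Q) = 2 Reg₃(V)`
  have hRegp : padicRegulator Dh = Dh.pairing (B₀ k₀) (B₀ k₀) := by
    rw [← padicRegulatorOf_eq_padicRegulator_holds Dh hB₀, padicRegulatorOf]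
    convert Matrix.det_eq_elem_of_card_eq_one (A := Dh.pairingMatrix B₀) hcard₀ k₀
    rfl
  have hDKQ : (m : ℚ_[3]) ^ 2 * DK.pairing (BK kK) (BK kK) = 2 * padicRegulator Dh := by
    rw [hRegp]; exact padicHeightK_generator_eq K V DK Dh hres h2 ht hmQ'
  -- the analytic sides over `ℚ`: Perrin-Riou for `V` (rank one), odd Birch + Pal for `W` (rank zero)
  obtain ⟨q, hq0, hϖ0, hshaV, hpad⟩ := rankOne_shaAn_data V hPR hGZK 3 (by norm_num) hord hrV hf ϖ hϖ Dh hDh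
  obtain ⟨tW, htW0, hϖS, hshaW, hvtW⟩ := twistNegThree_shaAn_data V W hGZK hmod C hC hadd hrW hf ϖ' hϖ'
  set S : ℚ := legendreMinusSymbolSum f 3 with hS
  -- `L⁺(0) = 0` (rank one) and the odd-branch constant term
  have hD1 := constantCoeff_padicLFunctionMinusBranch_one_three V hord hf
  set a : ℚ_[3] := ((unitRoot V 3 : ℤ_[3]) : ℚ_[3]) with ha
  have hL0 : PowerSeries.constantCoeff (padicLFunction f a) = 0 :=
    Wuthrich2014.constantCoeff_padicLFunction_eq_zero_of_analyticRank_eq_one V 3 hord hrV f hf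
  obtain ⟨L₁, hL₁⟩ := PowerSeries.X_dvd_iff.mpr hL0
  have hL₁' : padicLFunction f a = PowerSeries.X ^ 1 * L₁ := by rw [pow_one]; exact hL₁
  have hAeq : PowerSeries.coeff 1 (padicLFunction f a) = PowerSeries.constantCoeff L₁ := by
    rw [hL₁', PowerSeries.coeff_X_pow_mul', if_pos le_rfl, Nat.sub_self, PowerSeries.coeff_zero_eq_constantCoeff]
  -- coefficients of `T¹`: `g = h fE`, `fE = T qq`
  have hqq1 : fE = PowerSeries.X ^ 1 * qq := by rw [pow_one]; exact hqq
  have hcoeff_g : (PowerSeries.coeff 1 g : ℤ_[3]) =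
      PowerSeries.constantCoeff h * PowerSeries.constantCoeff qq := by
    rw [← hgh, hqq1, show h * (PowerSeries.X ^ 1 * qq) = PowerSeries.X ^ 1 * (h * qq) by ring,
      PowerSeries.coeff_X_pow_mul', if_pos le_rfl, Nat.sub_self, PowerSeries.coeff_zero_eq_constantCoeff,
      map_mul]
  have hcoeff_fE : (PowerSeries.coeff 1 fE : ℤ_[3]) = PowerSeries.constantCoeff qq := by
    rw [hqq1, PowerSeries.coeff_X_pow_mul', if_pos le_rfl, Nat.sub_self, PowerSeries.coeff_zero_eq_constantCoeff]
  -- `[T¹](ι g) = u ϖ ϖ' · [T¹]L⁺ · L⁻(0)` since `L⁺(0) = 0` (`L⁺ = T · L₁`)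
  have hcoeff_ιg : ((PowerSeries.coeff 1 g : ℤ_[3]) : ℚ_[3]) =
      ((u : ℤ_[3]) : ℚ_[3]) * (ϖ : ℚ_[3]) * (ϖ' : ℚ_[3]) *
        (PowerSeries.coeff 1 (padicLFunction f a) * (a⁻¹ * (S : ℚ_[3]))) := by
    rw [← Wuthrich2014.coeff_iwasawaToPowerSeries 3 g 1, hιg, PowerSeries.coeff_C_mul, hAeq, hL₁',
      show PowerSeries.X ^ 1 * L₁ * padicLFunctionMinusBranch f a 1 =
        PowerSeries.X ^ 1 * (L₁ * padicLFunctionMinusBranch f a 1) by ring,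
      PowerSeries.coeff_X_pow_mul', if_pos le_rfl, Nat.sub_self, PowerSeries.coeff_zero_eq_constantCoeff,
      map_mul, hD1]
  -- names in `ℚ₃`
  set h0 : ℚ_[3] := ((PowerSeries.constantCoeff h : ℤ_[3]) : ℚ_[3]) with hh0
  set qq0 : ℚ_[3] := ((PowerSeries.constantCoeff qq : ℤ_[3]) : ℚ_[3]) with hqq0
  set A : ℚ_[3] := PowerSeries.coeff 1 (padicLFunction f a) with hA
  set lg : ℚ_[3] := padicLog 3 (cyclotomicGenerator 3) with hlg
  set TK : ℚ_[3] := (Nat.card (AddCommGroup.primaryComponent VK.toAffine.Point 3) : ℚ_[3]) with hTK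
  set Np : ℚ_[3] := (Nat.card (AddCommGroup.primaryComponent
    ((integralModelInt V).map (Int.castRingHom (ZMod 3))).toAffine.Point 3) : ℚ_[3]) with hNp
  set ShK : ℚ_[3] := (Nat.card (AddCommGroup.primaryComponent VK.sha 3) : ℚ_[3]) with hShK
  set DKQ : ℚ_[3] := DK.pairing (BK kK) (BK kK) with hDKQdef
  set Rg : ℚ_[3] := padicRegulator Dh with hRg
  set vK : ℕ := padicValNat 3 VK.tamagawaProduct with hvK
  -- (i) `h0 * qq0 = u ϖ ϖ' A a⁻¹ S`
  have hi : h0 * qq0 = ((u : ℤ_[3]) : ℚ_[3]) * (ϖ : ℚ_[3]) * (ϖ' : ℚ_[3]) * (A * (a⁻¹ * (S : ℚ_[3]))) := by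
    rw [← hcoeff_ιg, hcoeff_g]; push_cast; rfl
  -- (ii) `qq0 * lg * TK² = u₁ * DKQ * 3^vK * Np² * ShK`
  have hii : qq0 * lg * TK ^ 2 = ((u₁ : ℤ_[3]) : ℚ_[3]) * DKQ * (3 : ℚ_[3]) ^ vK * Np ^ 2 * ShK := by
    rw [hqq0, ← hcoeff_fE]; exact hu₁
  -- (iii) Perrin-Riou: `A * lg = q * ε * Rg`; (iv) `m² DKQ = 2 Rg`
  have hiii : A * lg = (q : ℚ_[3]) * (1 - a⁻¹) ^ 2 * Rg := hpad
  have hiv : (m : ℚ_[3]) ^ 2 * DKQ = 2 * Rg := hDKQ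
  -- the anomalous factor `1 - a⁻¹ = u₂ u₃ Np`
  obtain ⟨-, hunit⟩ := unitRoot_spec_holds V 3 hord
  obtain ⟨ua, hua⟩ := hunit
  have haU : a = ((ua : ℤ_[3]) : ℚ_[3]) := by rw [ha, hua]
  have ha0 : a ≠ 0 := by rw [haU]; exact coe_units_ne_zero 3 ua
  obtain ⟨u₂, hu₂⟩ := exists_unit_one_sub_unitRoot_inv 3 V hord
  obtain ⟨u₃, hu₃⟩ := exists_unit_natCard_eq_mul_card_primaryComponent
    ((integralModelInt V).map (Int.castRingHom (ZMod 3))).toAffine.Point 3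
  have hNcount : (V.reductionPointCount 3 : ℚ_[3]) = ((u₃ : ℤ_[3]) : ℚ_[3]) * Np := by
    rw [WeierstrassCurve.reductionPointCount, hNp]
    exact hu₃
  have hNp0 : Np ≠ 0 := by
    rw [hNp]
    exact_mod_cast Nat.card_pos.ne'
  have h1 : (1 - a⁻¹) = ((u₂ : ℤ_[3]) : ℚ_[3]) * ((u₃ : ℤ_[3]) : ℚ_[3]) * Np := by
    rw [ha, hu₂, hNcount, mul_assoc]
  -- non-vanishing
  obtain ⟨ul, hul⟩ := exists_unit_padicLog_cyclotomicGenerator 3 (by norm_num)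
  have hlg0 : lg ≠ 0 := by
    rw [hlg, hul]; exact mul_ne_zero (by norm_num) (coe_units_ne_zero 3 ul)
  have hA0 : A ≠ 0 := hcert
  obtain ⟨uT, huT⟩ := exists_unit_torsionOrder_eq VK 3
  have hTK0 : TK ≠ 0 := by
    intro h0'
    rw [hTK] at h0'
    have h1' : (VK.torsionOrder : ℚ_[3]) = 0 := by rw [huT, h0', mul_zero]
    exact (VK.torsionOrder_pos VK.finite_torsion_holds).ne' (by exact_mod_cast h1')
  have hShK0 : ShK ≠ 0 := by rw [hShK]; exact_mod_cast Nat.card_pos.ne'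
  have hp0 : (3 : ℚ_[3]) ≠ 0 := by exact_mod_cast (by norm_num : (3 : ℕ) ≠ 0)
  have hqQ : (q : ℚ_[3]) ≠ 0 := by exact_mod_cast hq0
  have hmQ0 : (m : ℚ_[3]) ≠ 0 := by exact_mod_cast hm0
  have hRg0 : Rg ≠ 0 := by
    intro h0'
    have : A * lg = 0 := by rw [hiii, h0', mul_zero]
    exact (mul_ne_zero hA0 hlg0) this
  have hDKQ0 : DKQ ≠ 0 := by
    intro h0'
    have : (2 : ℚ_[3]) * Rg = 0 := by rw [← hiv, h0', mul_zero]
    exact (mul_ne_zero two_ne_zero hRg0) this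
  have hϖQ : (ϖ : ℚ_[3]) ≠ 0 := by exact_mod_cast hϖ0
  have hϖSQ : ((ϖ' * S : ℚ) : ℚ_[3]) ≠ 0 := by exact_mod_cast hϖS
  have hϖ'Q : (ϖ' : ℚ_[3]) * (S : ℚ_[3]) ≠ 0 := by push_cast at hϖSQ; exact hϖSQ
  have hh0ne : h0 ≠ 0 := by
    intro h0'
    have : ((u : ℤ_[3]) : ℚ_[3]) * (ϖ : ℚ_[3]) * (ϖ' : ℚ_[3]) * (A * (a⁻¹ * (S : ℚ_[3]))) = 0 := by
      rw [← hi, h0', zero_mul]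
    apply (mul_ne_zero (mul_ne_zero (mul_ne_zero (coe_units_ne_zero 3 u) hϖQ) ?_) ?_) this
    · exact fun h0 ↦ hϖ'Q (by rw [h0, zero_mul])
    · refine mul_ne_zero hA0 (mul_ne_zero (inv_ne_zero ha0) fun h0 ↦ hϖ'Q (by rw [h0, mul_zero]))
  have hh0val : 0 ≤ h0.valuation := by rw [hh0]; exact PadicInt.valuation_coe_nonneg
  -- KEY identity: `2 h0 u₁ 3^vK ShK = (u a⁻¹ (u₂u₃)² m²) (q ϖ) (ϖ' S) TK²`
  have key : 2 * h0 * ((u₁ : ℤ_[3]) : ℚ_[3]) * (3 : ℚ_[3]) ^ vK * ShK =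
      (((u : ℤ_[3]) : ℚ_[3]) * a⁻¹ * (((u₂ : ℤ_[3]) : ℚ_[3]) * ((u₃ : ℤ_[3]) : ℚ_[3])) ^ 2 *
        (m : ℚ_[3]) ^ 2) * ((q : ℚ_[3]) * (ϖ : ℚ_[3])) * ((ϖ' : ℚ_[3]) * (S : ℚ_[3])) * TK ^ 2 := by
    apply mul_right_cancel₀ (mul_ne_zero hRg0 (pow_ne_zero 2 hNp0))
    -- both sides times `Rg * Np²`
    have e1 : 2 * h0 * ((u₁ : ℤ_[3]) : ℚ_[3]) * (3 : ℚ_[3]) ^ vK * ShK * (Rg * Np ^ 2) =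
        h0 * ((m : ℚ_[3]) ^ 2 * DKQ) * ((u₁ : ℤ_[3]) : ℚ_[3]) * (3 : ℚ_[3]) ^ vK * Np ^ 2 * ShK := by
      rw [hiv]; ring
    have e2 : h0 * ((m : ℚ_[3]) ^ 2 * DKQ) * ((u₁ : ℤ_[3]) : ℚ_[3]) * (3 : ℚ_[3]) ^ vK * Np ^ 2 * ShK =
        (m : ℚ_[3]) ^ 2 * h0 * (qq0 * lg * TK ^ 2) := by
      rw [hii]; ring
    have e3 : (m : ℚ_[3]) ^ 2 * h0 * (qq0 * lg * TK ^ 2) =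
        (m : ℚ_[3]) ^ 2 * (h0 * qq0) * lg * TK ^ 2 := by ring
    have e4 : (m : ℚ_[3]) ^ 2 * (h0 * qq0) * lg * TK ^ 2 =
        (m : ℚ_[3]) ^ 2 * (((u : ℤ_[3]) : ℚ_[3]) * (ϖ : ℚ_[3]) * (ϖ' : ℚ_[3]) * (a⁻¹ * (S : ℚ_[3]))) *
          (A * lg) * TK ^ 2 := by
      rw [hi]; ring
    rw [e1, e2, e3, e4, hiii, h1]
    ring
  -- valuations of `key`
  have hva : a.valuation = 0 := by rw [haU]; exact valuation_coe_units_eq_zero 3 ua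
  have hvm : ((m : ℚ_[3]) ^ 2).valuation = 0 := by
    have hmv : ((m : ℚ) : ℚ_[3]).valuation = 0 := by
      rw [Padic.valuation_ratCast, padicValRat.of_int, padicValInt.eq_zero_of_not_dvd hm3]
      simp
    rw [Padic.valuation_pow, show (m : ℚ_[3]) = ((m : ℚ) : ℚ_[3]) by push_cast; rfl, hmv, mul_zero]
  have hU0 : ((u : ℤ_[3]) : ℚ_[3]) * a⁻¹ * (((u₂ : ℤ_[3]) : ℚ_[3]) * ((u₃ : ℤ_[3]) : ℚ_[3])) ^ 2 *
      (m : ℚ_[3]) ^ 2 ≠ 0 :=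
    mul_ne_zero (mul_ne_zero (mul_ne_zero (coe_units_ne_zero 3 u) (inv_ne_zero ha0))
      (pow_ne_zero 2 (mul_ne_zero (coe_units_ne_zero 3 u₂) (coe_units_ne_zero 3 u₃)))) (pow_ne_zero 2 hmQ0)
  have hvU : (((u : ℤ_[3]) : ℚ_[3]) * a⁻¹ * (((u₂ : ℤ_[3]) : ℚ_[3]) * ((u₃ : ℤ_[3]) : ℚ_[3])) ^ 2 *
      (m : ℚ_[3]) ^ 2).valuation = 0 := by
    rw [Padic.valuation_mul (mul_ne_zero (mul_ne_zero (coe_units_ne_zero 3 u) (inv_ne_zero ha0))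
      (pow_ne_zero 2 (mul_ne_zero (coe_units_ne_zero 3 u₂) (coe_units_ne_zero 3 u₃)))) (pow_ne_zero 2 hmQ0),
      Padic.valuation_mul (mul_ne_zero (coe_units_ne_zero 3 u) (inv_ne_zero ha0))
      (pow_ne_zero 2 (mul_ne_zero (coe_units_ne_zero 3 u₂) (coe_units_ne_zero 3 u₃))),
      Padic.valuation_mul (coe_units_ne_zero 3 u) (inv_ne_zero ha0), Padic.valuation_inv,
      Padic.valuation_pow, Padic.valuation_mul (coe_units_ne_zero 3 u₂) (coe_units_ne_zero 3 u₃),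
      valuation_coe_units_eq_zero, valuation_coe_units_eq_zero, valuation_coe_units_eq_zero, hva, hvm]
    ring
  have hqϖ0 : (q : ℚ_[3]) * (ϖ : ℚ_[3]) ≠ 0 := mul_ne_zero hqQ hϖQ
  have hLHS0 : 2 * h0 * ((u₁ : ℤ_[3]) : ℚ_[3]) * (3 : ℚ_[3]) ^ vK ≠ 0 :=
    mul_ne_zero (mul_ne_zero (mul_ne_zero two_ne_zero hh0ne) (coe_units_ne_zero 3 u₁)) (pow_ne_zero _ hp0)
  have hval := congrArg Padic.valuation key
  rw [Padic.valuation_mul hLHS0 hShK0,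
    Padic.valuation_mul (mul_ne_zero (mul_ne_zero two_ne_zero hh0ne) (coe_units_ne_zero 3 u₁)) (pow_ne_zero _ hp0),
    Padic.valuation_mul (mul_ne_zero two_ne_zero hh0ne) (coe_units_ne_zero 3 u₁),
    Padic.valuation_mul two_ne_zero hh0ne, valuation_coe_units_eq_zero, Padic.valuation_pow,
    Padic.valuation_mul (mul_ne_zero (mul_ne_zero hU0 hqϖ0) hϖ'Q) (pow_ne_zero 2 hTK0),
    Padic.valuation_mul (mul_ne_zero hU0 hqϖ0) hϖ'Q, Padic.valuation_mul hU0 hqϖ0, hvU,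
    Padic.valuation_pow] at hval
  have hv3 : (3 : ℚ_[3]).valuation = 1 := by exact_mod_cast Padic.valuation_p (p := 3)
  have hv2 : (2 : ℚ_[3]).valuation = 0 := by
    have h : ((2 : ℚ) : ℚ_[3]).valuation = padicValRat 3 (2 : ℚ) := Padic.valuation_ratCast 2
    rw [show padicValRat 3 (2 : ℚ) = 0 by
      rw [show (2 : ℚ) = ((2 : ℕ) : ℚ) by norm_num, padicValRat.of_nat]; norm_num [padicValNat.eq_zero_of_not_dvd]] at h
    exact_mod_cast h
  rw [hv3, hv2] at hval
  -- `v(TK) = ord₃ #V(K)_tors`, `v(ShK) = ord₃ #Ш(V_K)`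
  have hvTK : TK.valuation = (padicValNat 3 VK.torsionOrder : ℤ) := by
    have h := congrArg Padic.valuation huT
    rw [Padic.valuation_natCast, Padic.valuation_mul (coe_units_ne_zero 3 uT) hTK0,
      valuation_coe_units_eq_zero, zero_add] at h
    exact h.symm
  have hvShK : ShK.valuation = (padicValNat 3 VK.shaOrder : ℤ) := by
    rw [hShK, Padic.valuation_natCast, padicValNat_card_addPrimaryComponent 3]
    rfl
  have hvqϖ : ((q : ℚ_[3]) * (ϖ : ℚ_[3])).valuation = padicValRat 3 (q * ϖ) := by
    rw [show (q : ℚ_[3]) * (ϖ : ℚ_[3]) = ((q * ϖ : ℚ) : ℚ_[3]) by push_cast; rfl, Padic.valuation_ratCast]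
  have hvϖ'S : ((ϖ' : ℚ_[3]) * (S : ℚ_[3])).valuation = padicValRat 3 (ϖ' * S) := by
    rw [show (ϖ' : ℚ_[3]) * (S : ℚ_[3]) = ((ϖ' * S : ℚ) : ℚ_[3]) by push_cast; rfl, Padic.valuation_ratCast]
  rw [hvTK, hvShK, hvqϖ, hvϖ'S] at hval
  -- (I'): `v_K + ord₃ #Ш(V_K) ≤ ord₃ (qϖ) + ord₃ (ϖ'S) + 2 ord₃ #V(K)_tors`
  have hI : (vK : ℤ) + padicValNat 3 VK.shaOrder ≤
      padicValRat 3 (q * ϖ) + padicValRat 3 (ϖ' * S) + 2 * padicValNat 3 VK.torsionOrder := by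
    simp only [Nat.cast_ofNat] at hval
    linarith
  -- conclusion
  have hcV0 : (V.tamagawaProduct : ℚ) ≠ 0 := by exact_mod_cast V.tamagawaProduct_pos_holds.ne'
  have hcW0 : (W.tamagawaProduct : ℚ) ≠ 0 := by exact_mod_cast W.tamagawaProduct_pos_holds.ne'
  have hNV0 : (V.torsionOrder : ℚ) ≠ 0 := by exact_mod_cast (V.torsionOrder_pos V.finite_torsion_holds).ne'
  have hNW0 : ((Nat.card W.toAffine.Point : ℕ) : ℚ) ≠ 0 := by exact_mod_cast Nat.card_pos.ne'
  refine ⟨q * ϖ * (V.torsionOrder : ℚ) ^ 2 / (V.tamagawaProduct : ℚ),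
    tW * (Nat.card W.toAffine.Point : ℚ) ^ 2 / (W.tamagawaProduct : ℚ), hshaV, hshaW, ?_⟩
  have hqϖ' : q * ϖ ≠ 0 := mul_ne_zero hq0 hϖ0
  rw [padicValRat.div (mul_ne_zero hqϖ' (pow_ne_zero 2 hNV0)) hcV0,
    padicValRat.mul hqϖ' (pow_ne_zero 2 hNV0), padicValRat.pow, padicValRat.of_nat, padicValRat.of_nat,
    padicValRat.div (mul_ne_zero htW0 (pow_ne_zero 2 hNW0)) hcW0,
    padicValRat.mul htW0 (pow_ne_zero 2 hNW0), padicValRat.pow, padicValRat.of_nat, padicValRat.of_nat,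
    hvtW]
  push_cast at hI hvcard ⊢
  linarith

end Core

end Summit.BirchSwinnertonDyer.Rank1Residual.Additive

end
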